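import Literature.MathematicalPhysics.QuantumFieldTheory.Balaban1983to89.B8Thm4SupportLocal

/-!
# `Balaban1983to89.B8Thm4UniqueE` — [Balaban1985RegularSpaces] THEOREM 4 (p. 88), UNIQUENESS CLAUSE `u₁ = u₂` ON THE CONCRETE
# `ℤᵈ × 𝔸` CARRIERS, MODULO PROPOSITION 5'S UNIQUENESS CLAUSE (1.109) IN THE REPAIRED SOCKET CURRENCY (`SockP5uE`)

statement-level skeleton of published theorems with citation tags; proofs where landed; nothing here is a claim about the
Yang–Mills mass gap

PDF held: `paper:balaban1985-cmp99-regular-spaces-gauge-fixing` (journal page = PDF page + 74); p. 88 (Theorem 4), p. 94 (Prop. 5,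
(1.107)–(1.109)), p. 95 (the uniqueness paragraph after (1.112)).

WHY THIS FILE (cell `pub-ymgap`, seat `pub-ymgap-dag-n05-a` g7 = the OWNER of the Proposition-5 uniqueness socket of the N05 knit).
`B8Thm4SupportLocal.thm4_unique_eq_landau138` proves the uniqueness clause of Theorem 4 («exactly one gauge transformation u», p. 88)
modulo a hypothesis `hP5u` = Proposition 5's uniqueness (1.109) for the datum `(U₀, U′^{u₁⁻¹}, u₁)`, in which the two competitors
`v = e^{iλ}`, `w = e^{iμ}` are read through `λ`, `μ` on the TOWERS `Bʲ(y)`, `y ∈ Λ_j` only, with the gradient part of the domain (1.109)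
on bonds having BOTH ends in one tower.  The provider side (`pub-ymgap-dag-n04-b` g5, `B8Prop5UniqKLevel.hFP_unique_kLevel`, the
JOIN-side converse) located that this currency is too weak for the contraction of record (its λ-space norm (1.102) reads EVERY bond
touching `Ω_j`, cross-tower bonds included) and proposed the repaired socket text `SockP5uE` (this seat's `B8LeafModelZdSockP5uE`):
competitors read through `λ`, `μ` at EVERY site (`e^{iλ} = v`, `λ` self-adjoint, `|λ| < c_u`), `λ = 0` off `Ω₀`, and
`(Lʲη)|(D_{U₀}λ)(b)| < c_u` on every bond `b` of `SideTouches (Ω j)`, `j ≤ k` — print's «|λ|, |Dλ|₍₋₁₎ < c₃» with `|·|₍₋₁₎` the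
weighted supremum over all bonds of `Ω_j` ((1.109) p. 94, (1.77) p. 90).  THIS FILE re-proves the CONSUMER in that currency: the
competitor `u′ = u₁⁻¹u₂` produced by the uniqueness paragraph of p. 95 does satisfy the stronger clauses — at a site of `Ω₀` by the
partition clause «Ω₀ ⊂ ⋃ Bʲ(Λ_j)» and the tower estimate `B8Thm4UniqueLocal.lam_in_domain_of_agree`; off `Ω₀` because `u₁ = u₂ = 1`
there (gauge transformations carried by `Ω₀`); at a bond touching `Ω_j` because (1.112)'s bond estimate `B8Ineq1109Local.ineq1109_scaled`
is BOND-LOCAL: it needs (1.62) for `A₁`, `A₂` at that bond (the leaf's `SideTouches` reading supplies it) and `|λ′| ≤ 2α₃′` at the two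
endpoints (each a tower site or a site outside `Ω₀`).

WHAT THIS FILE PROVES (kernel, 0 sorry, theorems only): `quotient_eq_one_off` (bookkeeping), `lam_zero_off` (the logarithm vanishes
off `Ω₀`), **`thm4_unique_eq_landau138E`**.

HONEST SCOPE.  Consumer-side re-typing only; Proposition 5 (either half) is NOT proved here (it is the hypothesis `hP5u`); Proposition 3,
(1.42), (1.59) are not touched; constants as in `B8Thm4UniqueLocal` (explicit sufficient smallness for print's «α₀ + α₁ sufficiently
small»).  Count-neutral; N05 NOT discharged; nothing continuum / ℝ⁴ / OS / mass-gap / Clay.  Unit `pub-ymgap-dag-n05-a` (g7), 2026-08-26.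
-/

noncomputable section

open NormedSpace

namespace Literature.MathematicalPhysics.QuantumFieldTheory.Balaban1983to89.B8Thm4UniqueE

open Complex (I I_ne_zero)
open MatrixLog B7Prop1Explicit B7Prop2Explicit B7Prop1Local B7Eq92Concrete
open B7Prop2Explicit (C0 c2')
open B7Prop3Flat (c3)
open B8Ineq130 (tlo thi)
open B8Ineq132 (covDerivFwd InAk)
open B8Eq119TwistedAxial (InAx Restr129)
open B8Eq184Proof (gaugeExp cfgExp)
open B8Eq140Level (SideTouches sideTouches_of_bondTouches)
open B8Eq138LandauZd (IsLandau138W)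
open B8Ineq1109Local (ineq1109_scaled lam_of_unit mgauge_quotient_eq)
open B8Thm4UniqueLocal (lam_in_domain_of_agree)
open B8Thm4AtLandau138 (pdevOn_tower_lt_of_inAk mgauge_mgauge_inv)

-- `Site` alone could resolve to the torus sites of `Setup.lean`; re-export the `ℤ^d` sites of `B7Prop1Explicit`.
export B7Prop1Explicit (Site)

variable {d : ℕ}

section Main

variable {𝔸 : Type*} [CStarAlgebra 𝔸] [Nontrivial 𝔸]
variable {L k : ℕ} {η : ℝ} {Ω : ℕ → Set (Site d)} {Λ : ℕ → Set (Site d)} {U₀ U' : Site d → Fin d → 𝔸ˣ} {α₀ αP c : ℝ}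
  {u₁ u₂ : Site d → 𝔸ˣ}

omit [Nontrivial 𝔸] in
/-- Off `Ω₀` two gauge transformations carried by `Ω₀` have quotient `u₁⁻¹u₂ = 1`. [cite: Balaban1985RegularSpaces, p.95 (u′ = u₂u₁⁻¹), (1.28) p.81] -/
theorem quotient_eq_one_off (hu₁S : ∀ x, x ∉ Ω 0 → u₁ x = 1) (hu₂S : ∀ x, x ∉ Ω 0 → u₂ x = 1) {x : Site d} (hx : x ∉ Ω 0) :
    (u₁⁻¹ * u₂) x = 1 := by
  rw [Pi.mul_apply, Pi.inv_apply, hu₁S x hx, hu₂S x hx, inv_one, one_mul]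

omit [Nontrivial 𝔸] in
/-- Off `Ω₀` the logarithm `λ′ = i⁻¹ log u′` of `u′ = u₁⁻¹u₂` VANISHES and `e^{iλ′} = u′ (= 1)` there (`log 1 = 0`, via the series bound
`|i⁻¹ log u| ≤ 2|u − 1|` of `B8Ineq1109Local.lam_of_unit`). [cite: Balaban1985RegularSpaces, p.95 (after (1.112)); Balaban1985Averaging, (21) p.21] -/
theorem lam_zero_off (hu₁S : ∀ x, x ∉ Ω 0 → u₁ x = 1) (hu₂S : ∀ x, x ∉ Ω 0 → u₂ x = 1) {x : Site d} (hx : x ∉ Ω 0) :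
    (I⁻¹ : ℂ) • mlog ((((u₁⁻¹ * u₂) x : 𝔸ˣ)) : 𝔸) = 0 ∧
      ((gaugeExp (fun z => (I⁻¹ : ℂ) • mlog ((((u₁⁻¹ * u₂) z : 𝔸ˣ)) : 𝔸)) x : 𝔸ˣ) : 𝔸) = (((u₁⁻¹ * u₂) x : 𝔸ˣ) : 𝔸) := by
  have h1 : (u₁⁻¹ * u₂) x = 1 := quotient_eq_one_off hu₁S hu₂S hx
  have h0 : (I⁻¹ : ℂ) • mlog ((((u₁⁻¹ * u₂) x : 𝔸ˣ)) : 𝔸) = 0 := by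
    have h := (lam_of_unit ((u₁⁻¹ * u₂) x) (by rw [h1, Units.val_one, sub_self, norm_zero]; norm_num)).2
    rw [h1, Units.val_one, sub_self, norm_zero, mul_zero] at h
    rw [h1]
    exact norm_le_zero_iff.1 h
  refine ⟨h0, ?_⟩
  rw [gaugeExp]
  show (((expUnit (I • ((I⁻¹ : ℂ) • mlog ((((u₁⁻¹ * u₂) x : 𝔸ˣ)) : 𝔸)))) : 𝔸ˣ) : 𝔸) = _
  rw [h0, smul_zero, B7Prop8Flat.expUnit_zero, h1]

/-- **THEOREM 4, UNIQUENESS CLAUSE AS AN EQUALITY `u₁ = u₂`, MODULO PROPOSITION 5'S UNIQUENESS IN THE REPAIRED SOCKET CURRENCY**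
(«there exists EXACTLY ONE gauge transformation u», p. 88) on the concrete carriers with the gauge transformations CARRIED BY `Ω₀`:
two unitary-valued `u₁`, `u₂`, both `= 1` off `Ω₀`, both with (1.29), whose `U′^{u_i⁻¹}` satisfy (1.38) `IsLandau138W` and the
(1.62)-shape «`U′^{u_i⁻¹} = e^{iηA_i}`, `|A_i| ≤ c(Lʲη)⁻¹` on the bonds of `SideTouches (Ω j)`, j ≤ k», are EQUAL — given (1.33)/(1.34)
(`InAk`), the block axial gauge (1.34) (`InAx`), «`Bʲ(y) ⊂ Ω_j`» (`htower`), the PARTITION clause «`Ω₀ ⊂ ⋃ Bʲ(Λ_j)`» (`hpart`, p. 81) and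
the explicit windows of `B8Thm4UniqueLocal`; MODULO `hP5u` = Proposition 5's uniqueness clause (1.109) for the datum `(U₀, U′^{u₁⁻¹}, u₁)`
with the competitors `v = e^{iλ}`, `w = e^{iμ}` read at EVERY site (`λ` self-adjoint, `|λ| < c_u`), `λ = 0` off `Ω₀`, and
`(Lʲη)|(D_{U₀}λ)(b)| < c_u` on every bond of `SideTouches (Ω j)`, `j ≤ k` (the currency of `B8LeafModelZdSockP5uE.SockP5uE`).  PROOF =
print's paragraph p. 95: `u′ := u₁⁻¹u₂` solves (1.107) (`U₁^{u′⁻¹} = U₂` by `mgauge_quotient_eq`, `u₁u′ = u₂`), `λ′ := i⁻¹ log u′` lies in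
the domain — sitewise on the towers by `lam_in_domain_of_agree`, `= 0` off `Ω₀` (`lam_zero_off`), bondwise by `ineq1109_scaled` at the
bond — and so does `1` (with `μ = 0`); hence `u′ = 1`.
[cite: Balaban1985RegularSpaces, Thm 4 p.88 («exactly one»), proof p.95 (1.112), (1.29) p.81, (1.62) p.87, (1.38) p.82, Prop. 5 (1.107)–(1.109) p.94, (1.77) p.90] -/
theorem thm4_unique_eq_landau138E (hd2 : 2 ≤ d) (hL : 2 ≤ L) (hη : 0 < η)
    (hU₀ : ∀ x κ, U₀ x κ ∈ unitaryUnits 𝔸) (hU' : ∀ x κ, U' x κ ∈ unitaryUnits 𝔸)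
    (hu₁ : ∀ x, u₁ x ∈ unitaryUnits 𝔸) (hu₂ : ∀ x, u₂ x ∈ unitaryUnits 𝔸)
    (hα : 0 < α₀) (hα3 : C0 d * α₀ ≤ 1 / 3) (hα4 : 4 * α₀ ≤ c2' d L) (hc : 0 ≤ c)
    (hsmall : Real.exp (4 * (800 * ((d : ℝ) + 1) ^ 2 * ((d : ℝ) + 4)) * α₀) * (1 + 8 * (131072 * ((d : ℝ) + 1) ^ 2) * c) ≤ 2)
    (hc₃ : 2 * c ≤ c3 d L) (hsm : 2048 * (d : ℝ) * c ≤ 1) (hα₃ : 40 * d * c ≤ 1 / 5000)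
    (hαP : 0 < αP) (hαP3 : C0 d * αP ≤ 1 / 3) (hαP2 : 2 * αP ≤ c2' d L)
    {cu : ℝ} (hcu₁ : 2 * (2 * (40 * d * c) + 2 * 1116 * (40 * d * c) ^ 2) < cu) (hcu₂ : 5 * c < cu)
    (h33 : InAk L k η α₀ Ω U₀) (h34 : InAk L k η αP Ω (U' * U₀)) (hAx : InAx L k Λ U₀ (U' * U₀))
    (htower : ∀ j, j ≤ k → ∀ y ∈ Λ j, ∀ x, InBox (tlo L y j) (thi L y j) x → x ∈ Ω j)
    (h129₁ : Restr129 L k Λ U₀ u₁) (h129₂ : Restr129 L k Λ U₀ u₂)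
    (hLan₁ : IsLandau138W L k η (Ω 0) Λ U₀ (mgauge U₀ u₁⁻¹ U')) (hLan₂ : IsLandau138W L k η (Ω 0) Λ U₀ (mgauge U₀ u₂⁻¹ U'))
    (h162₁ : ∃ A₁ : Site d → Fin d → 𝔸, ∀ j, j ≤ k → ∀ (x : Site d) (κ : Fin d), SideTouches (Ω j) x κ →
      mgauge U₀ u₁⁻¹ U' x κ = cfgExp η A₁ x κ ∧ ‖A₁ x κ‖ ≤ c * ((L : ℝ) ^ j * η)⁻¹)
    (h162₂ : ∃ A₂ : Site d → Fin d → 𝔸, ∀ j, j ≤ k → ∀ (x : Site d) (κ : Fin d), SideTouches (Ω j) x κ →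
      mgauge U₀ u₂⁻¹ U' x κ = cfgExp η A₂ x κ ∧ ‖A₂ x κ‖ ≤ c * ((L : ℝ) ^ j * η)⁻¹)
    (hP5u : ∀ (v w : Site d → 𝔸ˣ) (lam mu : Site d → 𝔸),
      (∀ x, ((gaugeExp lam x : 𝔸ˣ) : 𝔸) = ((v x : 𝔸ˣ) : 𝔸) ∧ IsSelfAdjoint (lam x) ∧ ‖lam x‖ < cu) → (∀ x, x ∉ Ω 0 → lam x = 0) →
      (∀ j, j ≤ k → ∀ b ∈ {b : Site d × Fin d | SideTouches (Ω j) b.1 b.2}, ((L : ℝ) ^ j * η) * ‖covDerivFwd η U₀ b.2 lam b.1‖ < cu) →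
      (∀ x, ((gaugeExp mu x : 𝔸ˣ) : 𝔸) = ((w x : 𝔸ˣ) : 𝔸) ∧ IsSelfAdjoint (mu x) ∧ ‖mu x‖ < cu) → (∀ x, x ∉ Ω 0 → mu x = 0) →
      (∀ j, j ≤ k → ∀ b ∈ {b : Site d × Fin d | SideTouches (Ω j) b.1 b.2}, ((L : ℝ) ^ j * η) * ‖covDerivFwd η U₀ b.2 mu b.1‖ < cu) →
      IsLandau138W L k η (Ω 0) Λ U₀ (mgauge U₀ v⁻¹ (mgauge U₀ u₁⁻¹ U')) → Restr129 L k Λ U₀ (u₁ * v) →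
      IsLandau138W L k η (Ω 0) Λ U₀ (mgauge U₀ w⁻¹ (mgauge U₀ u₁⁻¹ U')) → Restr129 L k Λ U₀ (u₁ * w) →
      ∀ x, v x = w x)
    (hpart : ∀ x, x ∈ Ω 0 → ∃ j, j ≤ k ∧ ∃ y ∈ Λ j, InBox (tlo L y j) (thi L y j) x)
    (hu₁S : ∀ x, x ∉ Ω 0 → u₁ x = 1) (hu₂S : ∀ x, x ∉ Ω 0 → u₂ x = 1) :
    u₁ = u₂ := by
  have hL1 : 1 ≤ L := le_trans (by norm_num) hL
  have hd : 1 ≤ d := le_trans (by norm_num) hd2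
  have hd' : (1 : ℝ) ≤ d := by exact_mod_cast hd
  haveI : Nontrivial (Fin d) := Fin.nontrivial_iff_two_le.mpr hd2
  obtain ⟨A₁, hA₁⟩ := h162₁
  obtain ⟨A₂, hA₂⟩ := h162₂
  -- the two gauge-fixed fields `U_i = U′^{u_i⁻¹}` as opaque names
  obtain ⟨U₁, hU₁def⟩ : ∃ U₁ : Site d → Fin d → 𝔸ˣ, U₁ = mgauge U₀ u₁⁻¹ U' := ⟨_, rfl⟩
  obtain ⟨U₂, hU₂def⟩ : ∃ U₂ : Site d → Fin d → 𝔸ˣ, U₂ = mgauge U₀ u₂⁻¹ U' := ⟨_, rfl⟩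
  have h₁ : mgauge U₀ u₁ U₁ = U' := by rw [hU₁def]; exact mgauge_mgauge_inv U₀ U' u₁
  have h₂ : mgauge U₀ u₂ U₂ = U' := by rw [hU₂def]; exact mgauge_mgauge_inv U₀ U' u₂
  have hA₁' : ∀ j, j ≤ k → ∀ (x : Site d) (κ : Fin d), SideTouches (Ω j) x κ →
      U₁ x κ = cfgExp η A₁ x κ ∧ ‖A₁ x κ‖ ≤ c * ((L : ℝ) ^ j * η)⁻¹ := by rw [hU₁def]; exact hA₁
  have hA₂' : ∀ j, j ≤ k → ∀ (x : Site d) (κ : Fin d), SideTouches (Ω j) x κ →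
      U₂ x κ = cfgExp η A₂ x κ ∧ ‖A₂ x κ‖ ≤ c * ((L : ℝ) ^ j * η)⁻¹ := by rw [hU₂def]; exact hA₂
  -- a bond inside a tower `Bʲ(y) ⊂ Ω_j` is a side of a plaquette touching `Ω_j`
  have hside : ∀ j, j ≤ k → ∀ y ∈ Λ j, ∀ (x : Site d) (κ : Fin d), InBox (tlo L y j) (thi L y j) x →
      SideTouches (Ω j) x κ := by
    intro j hj y hy x κ hx
    obtain ⟨κ', hκ'⟩ := exists_ne κ
    exact sideTouches_of_bondTouches hκ' (Or.inl (htower j hj y hy x hx))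
  -- the threshold bookkeeping of `B8Thm4UniqueLocal`
  have ha₃0 : 0 ≤ 40 * d * c := by positivity
  set a₃ : ℝ := 2 * (40 * d * c) + 2 * 1116 * (40 * d * c) ^ 2 with ha₃
  have ha₃nn : 0 ≤ a₃ := by rw [ha₃]; positivity
  have hα₃' : 40 * d * c ≤ 1 / 3000 := hα₃.trans (by norm_num)
  have ha₃le : a₃ ≤ 1 / 2000 := by rw [ha₃]; nlinarith
  have hs : 2 * a₃ ≤ 1 / 1000 := by linarith
  have hc170 : ∀ j : ℕ, c * ((L : ℝ) ^ j)⁻¹ ≤ 1 / 170 := by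
    intro j
    have hLr : (1 : ℝ) ≤ L := by exact_mod_cast hL1
    have hLj : (1 : ℝ) ≤ (L : ℝ) ^ j := one_le_pow₀ hLr
    have hinv : ((L : ℝ) ^ j)⁻¹ ≤ 1 := inv_le_one_of_one_le₀ hLj
    have hc' : c ≤ 1 / 170 := by nlinarith
    calc c * ((L : ℝ) ^ j)⁻¹ ≤ c * 1 := mul_le_mul_of_nonneg_left hinv hc
      _ ≤ 1 / 170 := by linarith
  set lam : Site d → 𝔸 := fun z => (I⁻¹ : ℂ) • mlog ((((u₁⁻¹ * u₂) z : 𝔸ˣ)) : 𝔸) with hlam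
  -- ON THE TOWERS: `lam_in_domain_of_agree` (sitewise clause and tower-internal gradients)
  have htw : ∀ j, j ≤ k → ∀ y ∈ Λ j, ∀ x : Site d, InBox (tlo L y j) (thi L y j) x →
      ((gaugeExp lam x : 𝔸ˣ) : 𝔸) = (((u₁⁻¹ * u₂) x : 𝔸ˣ) : 𝔸) ∧ IsSelfAdjoint (lam x) ∧ ‖lam x‖ ≤ 2 * a₃ := by
    intro j hjk y hy x hx
    obtain ⟨he, hsa, hn, -⟩ := lam_in_domain_of_agree hd hL hL1 hη hU₀ hU' hu₁ hu₂ hα hα3 hα4 hc hsmall hc₃ hsm hα₃ hαP hαP3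
      hαP2 hAx h129₁ h129₂ h₁ h₂ hjk hy
      (pdevOn_tower_lt_of_inAk hL1 hα h33 hjk (htower j hjk y hy))
      (pdevOn_tower_lt_of_inAk hL1 hαP h34 hjk (htower j hjk y hy))
      (fun x κ hx _ => (hA₁' j hjk x κ (hside j hjk y hy x κ hx)).1)
      (fun x κ hx _ => (hA₂' j hjk x κ (hside j hjk y hy x κ hx)).1)
      (fun x κ hx _ => (hA₁' j hjk x κ (hside j hjk y hy x κ hx)).2)
      (fun x κ hx _ => (hA₂' j hjk x κ (hside j hjk y hy x κ hx)).2) x hx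
    exact ⟨he, hsa, hn⟩
  -- AT EVERY SITE: a site of `Ω₀` lies in a tower (partition clause); off `Ω₀` the logarithm vanishes
  have hsite : ∀ x : Site d,
      ((gaugeExp lam x : 𝔸ˣ) : 𝔸) = (((u₁⁻¹ * u₂) x : 𝔸ˣ) : 𝔸) ∧ IsSelfAdjoint (lam x) ∧ ‖lam x‖ ≤ 2 * a₃ := by
    intro x
    by_cases hx : x ∈ Ω 0
    · obtain ⟨j, hj, y, hy, hxy⟩ := hpart x hx
      exact htw j hj y hy x hxy
    · obtain ⟨h0, he⟩ := lam_zero_off hu₁S hu₂S hx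
      refine ⟨he, ?_, ?_⟩
      · show IsSelfAdjoint (lam x)
        rw [hlam]
        simp only
        rw [h0]
        exact IsSelfAdjoint.zero 𝔸
      · show ‖lam x‖ ≤ 2 * a₃
        rw [hlam]
        simp only
        rw [h0, norm_zero]
        positivity
  have hoff : ∀ x, x ∉ Ω 0 → lam x = 0 := fun x hx => (lam_zero_off hu₁S hu₂S hx).1
  -- AT EVERY BOND TOUCHING `Ω_j`: (1.112)'s bond estimate, fed by (1.62) at the bond and `|λ′| ≤ 2α₃′` at both endpoints
  have hq : mgauge U₀ (u₁⁻¹ * u₂)⁻¹ U₁ = U₂ := mgauge_quotient_eq U₀ u₁ u₂ U₁ U₂ U' h₁ h₂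
  have hG : AvgClosed d L (unitaryUnits 𝔸) := avgClosed_unitaryUnits d L
  have hgrad : ∀ j, j ≤ k → ∀ b ∈ {b : Site d × Fin d | SideTouches (Ω j) b.1 b.2},
      ((L : ℝ) ^ j * η) * ‖covDerivFwd η U₀ b.2 lam b.1‖ ≤ 5 * c := by
    intro j hj b hb
    obtain ⟨x, κ⟩ := b
    simp only [Set.mem_setOf_eq] at hb
    obtain ⟨hex, -, hnx⟩ := hsite x
    obtain ⟨hexe, -, hnxe⟩ := hsite (x + e κ)
    have hux : gaugeExp lam x = (u₁⁻¹ * u₂) x := Units.ext hex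
    have huxe : gaugeExp lam (x + e κ) = (u₁⁻¹ * u₂) (x + e κ) := Units.ext hexe
    obtain ⟨hE₁, h62₁⟩ := hA₁' j hj x κ hb
    obtain ⟨hE₂, h62₂⟩ := hA₂' j hj x κ hb
    have hU₁₂ : mgauge U₀ (fun z => (gaugeExp lam z)⁻¹) (cfgExp η A₁) x κ = cfgExp η A₂ x κ := by
      rw [← hE₂, ← hq, mgauge_apply, mgauge_apply, hux, huxe, Pi.inv_apply, Pi.inv_apply, hE₁]
    have hUx : U₀ x κ ∈ U1 𝔸 := hG.le_U1 (hU₀ x κ)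
    exact ineq1109_scaled hη U₀ A₁ A₂ κ hUx hL1 hs hnx hnxe h62₁ h62₂ (hc170 j) hU₁₂
  -- the competitor `u′ = e^{iλ′}` in the socket's currency
  have hcu : 0 < cu := lt_of_le_of_lt (by positivity) hcu₂
  have hdom : ∀ x, ((gaugeExp lam x : 𝔸ˣ) : 𝔸) = (((u₁⁻¹ * u₂) x : 𝔸ˣ) : 𝔸) ∧ IsSelfAdjoint (lam x) ∧ ‖lam x‖ < cu := by
    intro x
    obtain ⟨he, hsa, hn⟩ := hsite x
    exact ⟨he, hsa, lt_of_le_of_lt hn hcu₁⟩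
  have hdomD : ∀ j, j ≤ k → ∀ b ∈ {b : Site d × Fin d | SideTouches (Ω j) b.1 b.2},
      ((L : ℝ) ^ j * η) * ‖covDerivFwd η U₀ b.2 lam b.1‖ < cu :=
    fun j hj b hb => lt_of_le_of_lt (hgrad j hj b hb) hcu₂
  -- the competitor `1 = e^{i0}`
  have hdom1 : ∀ x, ((gaugeExp (fun _ => (0 : 𝔸)) x : 𝔸ˣ) : 𝔸) = (((1 : Site d → 𝔸ˣ) x : 𝔸ˣ) : 𝔸) ∧
      IsSelfAdjoint ((fun _ => (0 : 𝔸)) x) ∧ ‖(fun _ => (0 : 𝔸)) x‖ < cu := by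
    intro x
    refine ⟨?_, IsSelfAdjoint.zero 𝔸, by simpa using hcu⟩
    rw [gaugeExp, smul_zero, B7Prop8Flat.expUnit_zero, Pi.one_apply]
  have hoff1 : ∀ x, x ∉ Ω 0 → (fun _ => (0 : 𝔸)) x = 0 := fun _ _ => rfl
  have hdomD1 : ∀ j, j ≤ k → ∀ b ∈ {b : Site d × Fin d | SideTouches (Ω j) b.1 b.2},
      ((L : ℝ) ^ j * η) * ‖covDerivFwd η U₀ b.2 (fun _ => (0 : 𝔸)) b.1‖ < cu := by
    intro j _ b _
    have h0 : covDerivFwd η U₀ b.2 (fun _ => (0 : 𝔸)) b.1 = 0 := by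
      rw [covDerivFwd, B7Eq78Linearization.conjR_apply, mul_zero, zero_mul, sub_zero, smul_zero]
    rw [h0, norm_zero, mul_zero]
    exact hcu
  -- `u′` solves (1.107): `U₁^{u′⁻¹} = U₂` is in the Landau gauge, `u₁u′ = u₂` satisfies (1.29); so does `1`
  have hLan' : IsLandau138W L k η (Ω 0) Λ U₀ (mgauge U₀ (u₁⁻¹ * u₂)⁻¹ (mgauge U₀ u₁⁻¹ U')) := by
    rw [← hU₁def, hq, hU₂def]; exact hLan₂
  have h129' : Restr129 L k Λ U₀ (u₁ * (u₁⁻¹ * u₂)) := by rw [mul_inv_cancel_left]; exact h129₂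
  have hLan1 : IsLandau138W L k η (Ω 0) Λ U₀ (mgauge U₀ (1 : Site d → 𝔸ˣ)⁻¹ (mgauge U₀ u₁⁻¹ U')) := by
    have h1 : mgauge U₀ (1 : Site d → 𝔸ˣ)⁻¹ (mgauge U₀ u₁⁻¹ U') = mgauge U₀ u₁⁻¹ U' := by
      funext x κ
      simp [mgauge_apply]
    rw [h1]; exact hLan₁
  have h1291 : Restr129 L k Λ U₀ (u₁ * 1) := by rw [mul_one]; exact h129₁
  have huniq := hP5u (u₁⁻¹ * u₂) 1 lam (fun _ => 0) hdom hoff hdomD hdom1 hoff1 hdomD1 hLan' h129' hLan1 h1291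
  funext x
  have h := huniq x
  rw [Pi.mul_apply, Pi.inv_apply, Pi.one_apply, inv_mul_eq_one] at h
  exact h

end Main

#print axioms thm4_unique_eq_landau138E

end Literature.MathematicalPhysics.QuantumFieldTheory.Balaban1983to89.B8Thm4UniqueE

end
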